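import Mathlib
import HarnessLib
import HarnessLib.Audit
import Summits.HubbardSuperconductivity.Statement
import HarnessLib.Audit.Status.Attr

/-!
Route: KkFloor

CLOSED (refuted) 2026-08-19T01:44:35Z by operator:999:2893249 — reason: refuted:stmt-HubbardSuperconductivity-10402 (KkBandLift) by Summit.HubbardSuperconductivity.HubbardSuperconductivity.Theorems.KkFloorKkBandLift_refuted — note: KkBandLift (10402), KkZenoShelf (10403) and KkSusceptibilityWindow (10404) refuted by accepted zero-sorry theorems KkFloorKkBandLift_refuted / KkFloorKkZenoShelf_refuted / KkFloorKkSusceptibilityWindow_refuted (b2b-kkfloor cell, 2026-08-18); route BROKEN rev 4 with no live restatement; closed per co. The file is kept as the record of this route; refuted decls are indexed as negative knowledge (`ledger negatives`).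

# Route KkFloor — Kramers–Kronig floor — an extensive measurement lift of the pair-monitored torus
on one band of monitoring strengths forces d-wave LRO of every ground state

It suffices to show X = KkBandLift (card kk-floor-pair-measured-abscissa-v2, audited new-mechanism):
there are U > 0,
δ ∈ (0,1/2), ε > 0, a band 0 < Y₁ < Y₂ and L₀ such that for every even L ≥ L₀ and every monitoring
strength y ∈ [Y₁,Y₂],
every eigenvector in the (N_L, S^z = 0) sector (N_L = 2⌊(1−δ)L²/2⌋) of the PAIR-MONITORED torus H_L
+ i y Π_L — H_L =
hubbardTorus 2 L 1 U, Π_L := L⁻² Δ_d†Δ_d, Δ_d = pairField dWaveFormFactor L — has eigenvalue of real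
part ≥ E₀(L) + εL²,
E₀(L) = minEnergyOn of the sector. Since Re λ = ⟨v,H_L v⟩ for a unit eigenvector v, X says:
collective d-wave pair
monitoring at any strength in the band lifts EVERY stationary state of the monitored torus an
extensive energy above the
ground energy, uniformly in L. The Kramers–Kronig floor (support KkFloorTheorem: the spectral
abscissa
a_L(z) = min Re spec(H_L + zΠ_L) is superharmonic in the complex pair coupling z, ≥ E₀ on Re z ≥ 0,
so its Poisson majorant
on the half-plane and the Rayleigh slope at z = 0⁺ give min over ALL sector ground states ψ of
⟨ψ,Π_Lψ⟩ ≥ (1/π)∫(a_L(iy) − E₀)⁺y⁻²dy)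
turns X into ⟨ψ, Δ_d†Δ_d ψ⟩ ≥ (ε(Y₂−Y₁)/(πY₂²))·L⁴ for every normalised sector ground state, i.e.
the summit at (U,δ)
(support KkLiftToSummit). The two ranked cruxes are the two ends from which the band is reachable
with a perturbative
handle: y → ∞ (KkZenoShelf, the card's measurement shelf (Z), whose Hermitian anchor is
KkPairVacuumGap) and y → 0
(KkSusceptibilityWindow, the card's K2 ∧ K3: curvature = pair-order susceptibility, no
undercutting).
Lean: `∃ U : ℝ, 0 < U ∧ ∃ δ ∈ Set.Ioo (0:ℝ) (1/2), ∃ ε : ℝ, 0 < ε ∧ ∃ Y₁ : ℝ, 0 < Y₁ ∧ ∃ Y₂ : ℝ, Y₁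
< Y₂ ∧ ∃ L₀ : ℕ, ∀ (L : ℕ) [NeZero L], L₀ ≤ L → Even L → ∀ y ∈ Set.Icc Y₁ Y₂, ∀ φ :
Literature.MathematicalPhysics.QuantumLattice.Fock
(Literature.MathematicalPhysics.QuantumLattice.Orb
(Literature.MathematicalPhysics.QuantumLattice.FermionTorus 2 L)), φ ∈
(Literature.MathematicalPhysics.QuantumLattice.szSector (2 * ⌊(1 - δ) * (L : ℝ) ^ 2 / 2⌋₊) 0) → φ ≠
0 → ∀ lam : ℂ, (Literature.MathematicalPhysics.QuantumLattice.hubbardTorus 2 L 1 U + (Complex.I * (y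
: ℂ)) • ((((1 : ℝ) / (L : ℝ) ^ 2 : ℝ) : ℂ) • (Matrix.conjTranspose
(Literature.MathematicalPhysics.QuantumLattice.pairField
Literature.MathematicalPhysics.QuantumLattice.dWaveFormFactor L) *
Literature.MathematicalPhysics.QuantumLattice.pairField
Literature.MathematicalPhysics.QuantumLattice.dWaveFormFactor L))) *ᵥ φ = lam • φ →
(Literature.MathematicalPhysics.QuantumLattice.hubbardTorus 2 L 1 U).minEnergyOn
(Literature.MathematicalPhysics.QuantumLattice.szSector (2 * ⌊(1 - δ) * (L : ℝ) ^ 2 / 2⌋₊) 0) + ε *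
(L : ℝ) ^ 2 ≤ lam.re`

## Assembly
Pure logic (theorem `closes` in glue.lean, sorry-free in Sketch.lean rc 0): KkLiftToSummit applied
to KkFloorTheorem and
KkBandLift is the summit; KkBandLift itself is reached from either ranked crux by the one-line
support items
KkShelfGivesBand (from KkZenoShelf) or KkWindowGivesBand (from KkSusceptibilityWindow). All
mathematics sits in the cruxes
and in the two provable support items KkFloorTheorem (potential theory) and KkLiftToSummit (sector +
even-side bookkeeping).

Rationale: WHY THIS LINE. Mechanism (card kk-floor-pair-measured-abscissa-v2): continue the BCS-deformation
coupling g of H_L − gΠ_L to the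
imaginary axis, where H_L + iyΠ_L is the effective Hamiltonian of the torus under continuous
collective monitoring of the
d-wave pair amplitude (the complex-U / two-body-loss dictionary of
doi:10.1103/physrevlett.126.110404 and
doi:10.1103/physrevlett.123.123601, here with a collective jump operator Δ_d/L); potential theory of
subharmonic
functions (Vesentini's theorem and the half-plane Poisson–Jensen majorant,
doi:10.1017/cbo9780511623776 Thm 6.4.2 and
§4.5; coupling-constant dispersion relations in the style of doi:10.1016/0003-4916(70)90240-x) then
bounds the minimum
of ⟨Δ_d†Δ_d⟩ over the WHOLE degenerate ground space from below by the Cauchy transform ∫ d_L(y) y⁻²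
dy of the
measurement lift d_L(y) = a_L(iy) − E₀(L) — the summit's 'every ground state' quantifier is exactly
the bounded quantity,
and the Koma–Tasaki tower (KomaTasaki1994) is harmless because tower states lift in parallel.
Imported area: complex
potential theory / non-normal spectral theory (spectral abscissa, doi:10.1016/0362-546x(94)90090-6)
applied to a
many-body pencil; no expansion in U or t, no reflection positivity, no quasi-free states, no second
model whose energy
must be certified. What it does that prior routes do not: TwistGap must certify a Hermitian operator
inequality
Π + λ(H − E₀) ≥ c with E₀ exact and DeformationLadder / KacWindowPenalty / BcsKacWindow an energy
sandwich between the
pure and a deformed model; here x → 0⁺ is taken exactly, E₀ cancels, and the price is moved to a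
half-plane spectral
INCLUSION for one non-Hermitian pencil, a statement of a new logical type on this summit with its
own certificate format
(complex Lyapunov matrices). The negatives index (1 entry, KLS-order openness) is not touched.

RANKED CRUXES. #0 KkBandLift (target) — X of § Thesis — at some (U,δ) in the summit's range, on some
fixed band y ∈ [Y₁,Y₂] of monitoring strengths, every sector eigenvalue of H_L + i y L⁻²Δ_d†Δ_d has
real part ≥ E₀(L) + εL² for all even L ≥ L₀ (extensive, L-uniform measurement lift on a set of
positive Cauchy weight). (why it might fail: At least as strong as S in content: the KK floor makes
it sufficient, but nothing makes it necessary; a stripe/PDW ground state at the chosen (U,δ), or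
sub-extensive 'creeping' eigenvectors of the non-normal pencil at every fixed y, leave no band with
an εL² lift.) [doi:10.1103/physrevlett.126.110404, doi:10.1016/0003-4916(70)90240-x, QinEtAl2020,
KomaTasaki1994]
#2 KkZenoShelf (crux) — the card's MEASUREMENT SHELF (Z) = K1: ∃ U > 0, δ ∈ (0,1/2), ε > 0, Y > 0,
L₀ such that for all even L ≥ L₀ and ALL y ≥ Y, every sector eigenvalue λ of H_L + i y L⁻²Δ_d†Δ_d
has Re λ ≥ E₀(L) + εL² ('strong collective pair monitoring lifts every attainable energy
extensively'); the end y = ∞ is the Zeno limit spec(P_K H_L P_K), K = ker Δ_d ∩ sector, so the shelf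
is to be reached by a 1/y expansion around the Zeno-projected Hamiltonian, uniform in L, on top of
KkPairVacuumGap. Gives KkBandLift with the band [Y, Y+1] (KkShelfGivesBand) and floor 2εL⁴/(πY) on
min_GS ⟨Δ_d†Δ_d⟩. [deps: KkPairVacuumGap] [difficulty: XL] (why it might fail: For Y ≤ y ≪ L² the
non-normal pencil is uncontrolled (Zeno freezing of Π_L needs y ≳ L²·t): nodal-pair or normal-like
eigenvectors with ⟨H⟩ − E₀ = o(L²) may persist at every fixed y; fails by design where the pure
model's ground state is a stripe (U≈8, δ=1/8).) [doi:10.1103/physrevlett.126.110404,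
doi:10.1103/physrevlett.123.123601, doi:10.1103/physreva.107.033332, QinEtAl2020, XuEtAl2024]
#3 KkSusceptibilityWindow (crux) — the card's SMALL-y WINDOW (K2 ∧ K3 in output form): ∃ U > 0, δ ∈
(0,1/2), κ > 0, y₁ > 0, L₀ such that for all even L ≥ L₀ and all |y| ≤ y₁, every sector eigenvalue λ
of H_L + i y L⁻²Δ_d†Δ_d has Re λ ≥ E₀(L) + κ y² L² — the lowest branch lifts at least quadratically
with curvature 2κL² (κ = half the pair-ORDER susceptibility density at g = 0, i.e. g = 0 interior to
the ordered phase of the BCS-deformed family H_L − gΠ_L) and no other branch undercuts it on an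
L-uniform window. Gives KkBandLift with band [y₁/2, y₁], ε = κy₁²/4 (KkWindowGivesBand) and floor
(2κy₁/π)L⁴ … up to constants. This is the entry point for the deformation routes: real-g control of
E₀(H_L − gΠ_L) continued to imaginary g. [difficulty: XL] (why it might fail: Needs an L-uniform
quadratic window: pair-order susceptibility density κ_L → κ < ∞, > 0 AND no undercutting for |y| ≤
y₁; for a Fermi-liquid normal state g = 0 is the critical point of the BCS-deformed family (Cooper
log, κ_L ~ log L), so y₁(L) → 0 unless the pure model orders.) [doi:10.1016/0003-4916(70)90240-x,
Scalapino1995, KomaTasaki1994, doi:10.1103/physrevb.47.7995]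
#4 KkPairVacuumGap (crux) — PAIR-VACUUM GAP (card P4(ii); the refuter audit's recommended first
target): ∃ U > 0, δ ∈ (0,1/2), ε > 0, L₀ such that for all even L ≥ L₀ every normalised φ in the
(N_L, 0) sector with Δ_d φ = 0 (no d-wave pair can be removed) has ⟨φ, H_L φ⟩ ≥ E₀(L) + εL². It is
the y = ∞ end of KkZenoShelf (a_L(i∞) = min spec of H_L compressed to ker Δ_d ∩ sector), hence
NECESSARY for it (KkShelfNeedsVacuumGap); Hermitian and variational; at small U it reduces to the
FREE pair-vacuum gap (kernel of the weighted pair-lowering operator Σ_k ĝ_d(k) c_(k↑)c_(−k↓) costs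
extensive kinetic energy) plus E₀ ≤ E_FS + UL²ρ²/4. [difficulty: L] (why it might fail: ker Δ_d ∩
sector is ≥ 55% of the sector at δ = 0.2 (codim/dim ≤ (ρ/(2−ρ))²); saturated-ferromagnet multiplets
lie in ker Δ_d (singlet pair removal kills them), so it is false wherever a Nagaoka-type ground
state occurs; near-nodal pair slots make ε small.) [doi:10.1103/physrev.147.392, Tasaki2020,
Yang1962, Scalapino1995]
#9 KkFloorTheorem (support) — the KRAMERS–KRONIG FLOOR (engine; finite-dimensional, classical
potential theory, no physics): for a Hermitian matrix A, a positive semidefinite B (stated as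
Hermitian with nonnegative quadratic form), a subspace V invariant under both, a real E below the
Rayleigh quotient of A on unit vectors of V, a unit ψ ∈ V with Aψ = Eψ, a set S ⊆ ℝ and ANY profile
d with E + d(y) ≤ Re λ for every eigenpair (λ, v), v ∈ V ∖ 0, of A + iyB with y ∈ S: ∫_S d(y)⁺ y⁻²
dy ≤ π·Re⟨ψ, Bψ⟩ (lower Lebesgue integral of ofReal(d(y)/y²)). Proof sketch: a(z) := min Re spec((A
+ zB)|_V) is continuous and SUPERharmonic on ℂ (Vesentini: log ρ(exp(−(A+zB)|_V)) = −a(z) is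
subharmonic; or the Gelfand-formula sub-mean-value argument); a ≥ E on Re z ≥ 0 by the numerical
range (Re λ = ⟨v,Av⟩ + Re z ⟨v,Bv⟩); w := (E − a) + P[a(i·) − E] is subharmonic on Re z > 0, bounded
above, with boundary values 0, so Phragmén–Lindelöf (auxiliary ε log|z+1|) gives a(x) ≥ E + (1/π)∫ x
(a(iy) − E)/(x² + y²) dy for x > 0; Rayleigh gives a(x) ≤ E + x⟨ψ,Bψ⟩; divide by x and let x → 0⁺
(monotone convergence); finally d ≤ a(i·) − E on S and restriction S ⊆ ℝ (lintegral monotonicity, no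
measurability needed). Equality iff no undercutting (Riesz mass zero) — not part of the item.
[difficulty: L] [doi:10.1017/cbo9780511623776, doi:10.1016/0362-546x(94)90090-6,
doi:10.1016/0003-4916(70)90240-x]
#9 KkShelfGivesBand (support) — KkZenoShelf → KkBandLift with the same (U, δ, ε, L₀) and the band
[Y, Y+1]; pure logic (proved as an example in the planner's Sketch.lean). [difficulty: provable-now]
[doi:10.1017/cbo9780511623776]
#9 KkWindowGivesBand (support) — KkSusceptibilityWindow → KkBandLift with the band [y₁/2, y₁] and ε
:= κ(y₁/2)² (κy²L² ≥ κ(y₁/2)²L² on the band); two lines of arithmetic (proved as an example in the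
planner's Sketch.lean). [difficulty: provable-now] [doi:10.1017/cbo9780511623776]
#9 KkShelfNeedsVacuumGap (support) — pointwise Zeno limit: for fixed (U, δ, ε, Y, L), if every
sector eigenvalue of H_L + i y L⁻²Δ_d†Δ_d has real part ≥ E₀(L) + εL² for all y ≥ Y, then every
normalised sector vector φ with Δ_d φ = 0 has ⟨φ,H_Lφ⟩ ≥ E₀(L) + εL². Proof: K := ker Δ_d ∩ sector =
ker Π_L ∩ sector; as y → ∞ exactly dim K eigenvalues of (H_L + iyΠ_L)|_sector converge to spec(P_K
H_L P_K |_K) (first-order reduction of the analytic family Π_L + εH_L, ε = 1/(iy), at the semisimple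
eigenvalue 0 of the Hermitian Π_L), the others have |Im| → ∞; pass to the limit in the shelf
inequality and use min spec(P_K H_L P_K|_K) ≤ ⟨φ,H_Lφ⟩. Makes KkPairVacuumGap a genuine kill test
for KkZenoShelf. [difficulty: M] [doi:10.1103/physreva.107.033332, doi:10.1017/cbo9780511623776]
#9 KkLiftToSummit (support) — bookkeeping glue KkFloorTheorem → KkBandLift →
HubbardSuperconductivity: at the witness (U,δ) of KkBandLift and even L ≥ max(L₀,2), instantiate
KkFloorTheorem with n = the Fock basis, A = H_L, B = Π_L = ((1/L²:ℝ):ℂ)•(Δ_dᴴΔ_d) (Hermitian,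
nonnegative form: pairField_conjTranspose_mul_self_posSemidef), V = szSector N_L 0 (invariant under
H_L and Δ_dᴴΔ_d: both conserve N and S^z), E = E₀(L) (≤ every unit Rayleigh quotient on the sector:
csInf_le with BddBelow; a normalised sector ground state ψ is an eigenvector with eigenvalue E₀ by
IsGroundStateInSector), S = [Y₁,Y₂], d ≡ εL²: the floor gives π L⁻² Re⟨ψ,Δ_dᴴΔ_dψ⟩ ≥ ∫_[Y₁,Y₂] εL²
y⁻² dy ≥ εL²(Y₂−Y₁)/Y₂², i.e. Re⟨ψ,Δ_dᴴΔ_dψ⟩ ≥ cL⁴ with c = ε(Y₂−Y₁)/(πY₂²) for EVERY normalised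
sector ground state; then the summit (= ∃ U>0, δ ∈ Ioo 0 (1/2), HasDWavePairFieldLROAt U δ by
Iff.rfl) follows by the even-side liminf bookkeeping already proved in
Theorems/WeakCouplingBCSWcbcsThesis.lean (hasTorusLRO_of_eventually_le, sum_pairFieldCorr_succ,
pairFieldCorr_succ_le keep the real liminf honest; restrict to even L = 2k as in
hasDWavePairFieldLROAt_of_forall_hasPairFieldLRO). Same task as TwistGap's TgThesisToSummit modulo
the floor. [difficulty: M] [Scalapino1995, ArovasBergKivelsonRaghu2022, Lieb1989]

TWO-LAYER PLAN. Foreseen glued splits (none filed now): KkZenoShelf ⇐ KkPairVacuumGap →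
ZenoStability → KkZenoShelf, where ZenoStability =
'the 1/y expansion of the Zeno group of (H_L + iyΠ_L)|_sector around P_K H_L P_K has L-uniform
radius, and the fast group
keeps ⟨H⟩ − E₀ ≥ εL²' (k = 2); KkSusceptibilityWindow ⇐ CurvatureFloor (κ_L ≥ κ > 0: pair-order
susceptibility density of
the BCS-deformed family, the deformation routes' real-g input) → NoUndercutWindow (for |y| ≤ y₁ the
abscissa is realised by
the branch continued from the ground space; tower states lift in parallel) → KkSusceptibilityWindow
(k = 2);
KkPairVacuumGap ⇐ FreePairVacuumGap (U = 0: kernel of the weighted pair-lowering operator costs ε₀L²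
kinetic energy) →
SmallURobustness (E₀ ≤ E_FS + UL²ρ²/4 < E_FS + ε₀L²) → KkPairVacuumGap (k = 2); KkLiftToSummit ⇐
SectorFloor →
EvenSideBookkeeping (k = 2) if a prover wants it.

KILL CRITERIA. (i) A universal softness theorem 'for every U, δ and every fixed y, min Re
spec_sector(H_L + iyΠ_L) − E₀(L) = o(L²)' refutes
KkBandLift, both cruxes and the line at once — close `refuted:KkBandLift`. (ii) KkPairVacuumGap
refuted (e.g. a
Nagaoka/phase-separated ground state inside ker Δ_d at every admissible (U,δ), or numerics showing
min_(ker Δ_d)⟨H⟩ − E₀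
bounded in L) kills KkZenoShelf via KkShelfNeedsVacuumGap — pivot: drop crux 2, the route lives on
KkSusceptibilityWindow
only, re-rank it 2. (iii) KkSusceptibilityWindow refuted by y₁(L) → 0 (Cooper-log curvature blow-up
at every (U,δ)) while
the shelf survives — drop crux 3. (iv) The attractive-U s-wave CONTROL (kit): paired-channel
fraction I/min⟨Π⟩ → 0 with L
or undercut scale y_u ∝ 1/L at U = −4 on 4×4 → 6×6 → 8×8 kills the Landau reading behind both cruxes
— retire
`exhausted` with the data. (v) KkFloorTheorem is classical mathematics; a Lean refutation can only
mean a misstated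
signature — repair by restating (refuted-misstated), never a pivot. (vi) S proved elsewhere moots
the route; ¬S (route NoGo)
closes it.

NOT DECOMPOSED YET. The 1/y Zeno expansion and its L-uniform radius (child of KkZenoShelf); the
curvature / no-undercut split of the window
(children of KkSusceptibilityWindow); the free pair-vacuum gap (child of KkPairVacuumGap); complex
Lyapunov certificates
{H − E₀ − εL², P} + iy[P, Π] ⪰ 0 (Im P ≠ 0 forced) as a PROOF FORMAT for the band — a prover's
choice, not an item; the
equality criterion (Riesz mass zero ⇔ no undercutting), the two-sided sandwich λ_min + I ≤ min_GS⟨Π⟩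
≤ max_GS⟨Π⟩ ≤ λ_max − I
and the λ_min(Π|_sector)·x term of the majorant (all provable refinements of KkFloorTheorem, not
needed for S); odd L;
the values of (U, δ, ε, Y); a definition `spectralAbscissaOn` (signatures are inlined through
eigenpairs today).

CHEAPEST FALSIFIER. Crux 4 on small tori (ED, minutes): dim(ker Δ_d ∩ sector) and min_(ker Δ_d ∩
sector)⟨H_L⟩ − E₀(L) at (U, δ) ≈ (4, 0.25) on
2×4 and 4×4 (then 6×6 by DMRG with the constraint as a penalty μΔ_d†Δ_d, μ → ∞): if the gap per site
does not stay
bounded below, KkPairVacuumGap and with it KkZenoShelf die. Equally cheap: the shelf profile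
d_L(y)/L² for Π_d on 4×4 at
(4, 0.25) versus 2×4 (sparse Arnoldi for the abscissa, as the card's kit j001664 did for the
attractive s-wave control,
where the paired fraction rose 0.30–0.57 → 0.657 ≈ 2/π and d(y) showed rise-then-shelf 0.100 / 1.16
/ 1.39 at y = 1 / 6.8 /
46). Not run in this session: the hub is compute-free and this plancard payload carries no kit
allowance; the card's jobs
j001438 / j001559 / j001664 are the standing evidence (floor never violated in 60 cases, max ratio
1.001).

NUMBERS. Floor inequality checked on 60 (cluster, sector, U, Π) cases, 54 nontrivial, 0 violations,
max ratio 1.001 (card, kit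
j001559). Tightness with Π = D from the free anchor: 99.8% (2×2), 99.6% (ring 6), 90–94% (2×3),
95–98% (2×4) of
E₀(U) − E_FS for U = 1…16; 30–50% at half filling (Mott delimiter d(∞) = 4.54 vs 8) (j001438).
Paired channels keep a
fraction 0.11–0.57 of min_GS⟨Π⟩ on 4–8 sites with undercut scale y_u ≈ 2–9; size step 4×4, U = −4
s-wave: 0.657 vs Landau
2/π = 0.637 (j001664). Operator norms: ‖localPair‖ ≤ 4√2, C_Π := sup_L L⁻⁴‖Δ_d‖² ≤ 32, so ‖Π_L‖ ≤
32L² and 0 ≤ d_L(y) ≤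
32L²·(something ≤ 1) — the shelf height ε is measured against e_cond (condensation energy density)
in the Landau reading
d_L(y)/L² ≈ min(c y², e_cond), floor = (2/π)m. Kernel size: codim(ker Δ_d ∩ sector)/dim ≤
(n/(M−n+1))² ≈ (ρ/(2−ρ))² =
0.44 at δ = 0.2 (ρ = 0.8 electrons per site, n = N_L/2 per spin, M = L²). Stripe caveat: no d-wave
LRO at (U, δ) = (8, 1/8)
and (4, ≈1/6) in the pure model (QinEtAl2020, XuEtAl2024) — aim at δ ≈ 0.2–0.35, U ≤ 4–6. Items at
open: 10.

DEFINITION REQUESTS. None filed: every signature is inlined through eigenpairs (φ ∈ szSector, φ ≠ 0,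
(H_L + i y Π_L) *ᵥ φ = λ • φ) and
`Matrix.minEnergyOn`; positive semidefiniteness in KkFloorTheorem is spelled IsHermitian +
nonnegative quadratic form
because the route-file header does not open `ComplexOrder`. Optional later (would shorten every item
and allow the
equality criterion to be filed): `spectralAbscissaOn (A : Matrix n n ℂ) (V : Submodule ℂ (n → ℂ)) :
ℝ` = min Re of the
V-eigenvalues, under Literature/MathematicalPhysics/QuantumLattice/FinDimSpectrum.

Novelty: Searches (2026-08-15, this planner): `lit galaxy search "imaginary coupling constant" --star all`
(13 panama + 15 pdf + 0
crabby; relevant only panama:216243013419070 Trefethen–Embree, Spectra and Pseudospectra, and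
panama:456134116769812
Bagarello–Gazeau, Non-Selfadjoint Operators in Quantum Physics — non-normal spectral theory, no
ground-state order bounds);
`lit galaxy search "spectral abscissa" --star all` (12 panama, all control/numerical analysis;
pdf/crabby stars timed out);
`lit search --source crossref "non-Hermitian fermionic superfluidity complex-valued interaction
BCS"` (10:
doi:10.1103/physrevlett.123.123601 Yamamoto–Nakagawa–Adachi–Takasan–Ueda–Kawakami 2019, mean-field
NH BCS with complex U;
doi:10.1103/physreva.103.013724 Iskin 2021; Moghaddam, integrable NH BCS thesis
doi:10.14264/uql.2014.207);
`lit search --source crossref "subharmonic ground state energy complex coupling constant lower bound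
expectation value"` (9:
doi:10.1007/s10910-016-0660-5 Marmorino–Black 2016 and doi:10.1007/s10910-012-0038-2 — Hermitian
Weinstein/Temple-type
lower bounds on ground-state expectation values of nonnegative operators, needing
gap/reference-energy input); local
hybrid index `lit search` unavailable this session (searchd rc 75, logged in NOTES); the card's
audited searches (crossref ×5,
zbMATH, galaxy pdf ×3, lit frontier 30 rows) are inherited and listed on the card.
Nearest prior art found: doi:10.1016/0003-4916(70)90240-x (Simon 1970: dispersion relation in a
coupling  [refs: 10.1103/physrevlett.123.123601, 10.1103/physreva.103.013724, 10.14264/uql.2014.207, 10.1007/s10910-016-0660-5, 10.1007/s10910-012-0038-2, 10.1016/0003-4916(70, 10.1017/cbo9780511623776, 10.1016/0362-546x(94, 10.1103/physrevlett.126.110404, doi:10.1103/physrevlett.123.123601, doi:10.1103/physreva.103.013724, doi:10.14264/uql.2014.207, doi:10.1007/s10910-016-0660-5, doi:10.1007/s10910-012-0038-2, do]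

Barriers (technique_class: potential-theory, nonhermitian-spectral-inclusion): - technique_class: potential-theory, nonhermitian-spectral-inclusion
- Literature.Barriers.HubbardSuperconductivity.LROForcesLowLyingStates: evaded — the floor bounds
min over the WHOLE ground space of the number-conserving sector Hamiltonian at finite L; no gap, no
uniqueness, no anomalous average is used, and the Horsch–von der Linden / Koma–Tasaki states live in
N ± 2 sectors or lift in parallel (same order density); the technique class (spectral inclusion for
a non-Hermitian pencil) is outside the barrier's class.
- Literature.Barriers.HubbardSuperconductivity.PositiveTemperatureNoPairLRO: not met — T = 0 sector
ground states only; β in −a = β⁻¹ log ρ(e^(−βH_z)) is a dummy and cancels identically.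
- Literature.Barriers.HubbardSuperconductivity.HohenbergMerminWagnerPairing: not met — no positive
temperature anywhere.
- Literature.Barriers.HubbardSuperconductivity.WeakCouplingCeiling: not engaged — no expansion in U;
the only expansions foreseen are in the probe strength (1/y at the Zeno end, y at the susceptibility
end); constants degrade at weak U (ε ~ e_cond ~ m²) but nothing is truncated.
- Literature.Barriers.HubbardSuperconductivity.StrongCouplingCeiling: not engaged — no expansion in
t/U; U fixed, intermediate.
- Literature.Barriers.HubbardSuperconductivity.PerturbativeInvisibilityOfPairing: not in class — no
power series in U of m, T_c or a gap.
- Literature.Barriers.HubbardSuperconductivity.GeneralizedHartreeFockNoPairing: not in class — no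
quasi-free state or vari

History (route lifecycle, newest last):
- 2026-08-16T04:06:50Z · AUTO-CRUX (backfill): KkBandLift — hypotheses of the deciding theorem that nothing in the route derives are cruxes (operator:999:1085951)
- 2026-08-16T10:08:20Z · rev 2: restated Assembly (stmt-HubbardSuperconductivity-10411 proved) — route-repair (ground-failed): Assembly (stmt-HubbardSuperconductivity-10411) was flagged ground.trivial (tauto) because it was the type of `closes` with the sup (planner-rground-HubbardSuperconductivity-KkFloo-88b68784-0)
- 2026-08-18T13:58:35Z · BROKEN — KkBandLift (stmt-HubbardSuperconductivity-10402, crux) refuted by Summit.HubbardSuperconductivity.HubbardSuperconductivity.Theorems.KkFloorKkBandLift_refuted @ 6e956a647ca2 (refuter-b2b-kkfloor-2-0)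
- 2026-08-18T13:59:35Z · BROKEN — KkZenoShelf (stmt-HubbardSuperconductivity-10403, crux) refuted by Summit.HubbardSuperconductivity.HubbardSuperconductivity.Theorems.KkFloorKkZenoShelf_refuted @ 6b564c6d0184 (gate)
- 2026-08-18T13:59:35Z · BROKEN — KkSusceptibilityWindow (stmt-HubbardSuperconductivity-10404, crux) refuted by Summit.HubbardSuperconductivity.HubbardSuperconductivity.Theorems.KkFloorKkSusceptibilityWindow_refuted @ 6b564c6d0184 (gate)
- 2026-08-19T01:44:35Z · CLOSED refuted — refuted:stmt-HubbardSuperconductivity-10402 (KkBandLift) by Summit.HubbardSuperconductivity.HubbardSuperconductivity.Theorems.KkFloorKkBandLift_refuted (operator:999:2893249)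

sub-problem: HubbardSuperconductivity · status: closed(refuted) · opened planner-plancard-HubbardSuperconductivity-Hub-5bbb8fc4-0 2026-08-15T16:14:48Z · rev 4 · ledger route-HubbardSuperconductivity-KkFloor
GENERATED by the gate from the ledger (D-0016/17). Provers cite these decls: `theorem foo : Summit.HubbardSuperconductivity.HubbardSuperconductivity.Theses.KkFloor.<Decl> := …` in Summits/HubbardSuperconductivity/HubbardSuperconductivity/Theorems/<Name>.lean.
-/

namespace Summit.HubbardSuperconductivity.HubbardSuperconductivity.Theses.KkFloor

open scoped BigOperators Topology Manifold Classical MeasureTheory ProbabilityTheory Matrix InnerProductSpace ComplexConjugate ContinuousMap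
open Filter Set Function TopologicalSpace MeasureTheory

attribute [summit_statement] _root_.HubbardSuperconductivity

open Literature.Hubbard

/-- item stmt-HubbardSuperconductivity-10402 · crux (kind.auto-crux: conjecture-grade) · rank 0 · closed · refuted by Summit.HubbardSuperconductivity.HubbardSuperconductivity.Theorems.KkFloorKkBandLift_refuted @ 6e956a647ca2 (refuter) · by planner
why it might fail: Stronger than S and presupposes it: on non-superconducting low-energy states Π_L = L⁻²Δ_d†Δ_d has O(1) matrix elements, so iyΠ_L lifts Re λ by O(y), not εL²; a stripe/PDW ground state at the chosen (U,δ), or sub-extensively lifted eigenvectors of the pencil at fixed y, leave no band.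
sources: doi:10.1103/physrevlett.126.110404, doi:10.1016/0003-4916(70)90240-x, QinEtAl2020, XuEtAl2024, KomaTasaki1994
[target] X of § Thesis — at some (U,δ) in the summit's range, on some fixed band y ∈ [Y₁,Y₂] of
monitoring strengths, every sector eigenvalue of H_L + i y L⁻²Δ_d†Δ_d has real part ≥ E₀(L) + εL²
for all even L ≥ L₀ (extensive, L-uniform measurement lift on a set of positive Cauchy weight). -/
@[route_item "route-HubbardSuperconductivity-KkFloor", crux]
def KkBandLift : Prop :=
  ∃ U : ℝ, 0 < U ∧ ∃ δ ∈ Set.Ioo (0:ℝ) (1/2), ∃ ε : ℝ, 0 < ε ∧ ∃ Y₁ : ℝ, 0 < Y₁ ∧ ∃ Y₂ : ℝ, Y₁ < Y₂ ∧ ∃ L₀ : ℕ, ∀ (L : ℕ) [NeZero L], L₀ ≤ L → Even L → ∀ y ∈ Set.Icc Y₁ Y₂, ∀ φ : Literature.MathematicalPhysics.QuantumLattice.Fock (Literature.MathematicalPhysics.QuantumLattice.Orb (Literature.MathematicalPhysics.QuantumLattice.FermionTorus 2 L)), φ ∈ (Literature.MathematicalPhysics.QuantumLattice.szSector (2 *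 ⌊(1 - δ) * (L : ℝ) ^ 2 / 2⌋₊) 0) → φ ≠ 0 → ∀ lam : ℂ, (Literature.MathematicalPhysics.QuantumLattice.hubbardTorus 2 L 1 U + (Complex.I * (y : ℂ)) • ((((1 : ℝ) / (L : ℝ) ^ 2 : ℝ) : ℂ) • (Matrix.conjTranspose (Literature.MathematicalPhysics.QuantumLattice.pairField Literature.MathematicalPhysics.QuantumLattice.dWaveFormFactor L) * Literature.MathematicalPhysics.QuantumLattice.pairField Literature.MathematicalPhysics.QuantumLattice.dWaveFormFactor L))) *ᵥ φ = lam • φ → (Literature.MathematicalPhysics.QuantumLattice.hubbardTorus 2 L 1 U).minEnergyOn (Literature.MathematicalPhysics.QuantumLattice.szSector (2 * ⌊(1 - δ) * (L : ℝ) ^ 2 / 2⌋₊) 0) + ε * (L : ℝ) ^ 2 ≤ lam.re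

/-- item stmt-HubbardSuperconductivity-10403 · crux · rank 2 · closed · refuted by Summit.HubbardSuperconductivity.HubbardSuperconductivity.Theorems.KkFloorKkZenoShelf_refuted @ 6b564c6d0184 (refuter) · by planner
why it might fail: No Zeno freezing at fixed y (needs y ≳ tL²/g_min²): normal-like eigenvectors with ⟨H⟩−E₀ = o(L²) may persist for Y ≤ y ≪ L²; its necessary y=∞ end KkPairVacuumGap has no free mechanism (ker Δ_d holds states at E_FS+O(t)): ε ≲ O(U²) correlation scale; dead at stripes (8,1/8).
sources: doi:10.1103/physrevlett.126.110404, doi:10.1103/physrevlett.123.123601, doi:10.1103/physreva.107.033332, doi:10.22331/q-2021-08-19-528, Kato1966, QinEtAl2020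
[crux] the card's MEASUREMENT SHELF (Z) = K1: ∃ U > 0, δ ∈ (0,1/2), ε > 0, Y > 0, L₀ such that for
all even L ≥ L₀ and ALL y ≥ Y, every sector eigenvalue λ of H_L + i y L⁻²Δ_d†Δ_d has Re λ ≥ E₀(L) +
εL² ('strong collective pair monitoring lifts every attainable energy extensively'); the end y = ∞
is the Zeno limit spec(P_K H_L P_K), K = ker Δ_d ∩ sector, so the shelf is to be reached by a 1/y
expansion around the Zeno-projected Hamiltonian, uniform in L, on top of KkPairVacuumGap. Gives
KkBandLift with the band [Y, Y+1] (KkShelfGivesBand) and floor 2εL⁴/(πY) on min_GS ⟨Δ_d†Δ_d⟩. [deps: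
KkPairVacuumGap] [difficulty: XL] -/
@[route_item "route-HubbardSuperconductivity-KkFloor"]
def KkZenoShelf : Prop :=
  ∃ U : ℝ, 0 < U ∧ ∃ δ ∈ Set.Ioo (0:ℝ) (1/2), ∃ ε : ℝ, 0 < ε ∧ ∃ Y : ℝ, 0 < Y ∧ ∃ L₀ : ℕ, ∀ (L : ℕ) [NeZero L], L₀ ≤ L → Even L → ∀ y : ℝ, Y ≤ y → ∀ φ : Literature.MathematicalPhysics.QuantumLattice.Fock (Literature.MathematicalPhysics.QuantumLattice.Orb (Literature.MathematicalPhysics.QuantumLattice.FermionTorus 2 L)), φ ∈ (Literature.MathematicalPhysics.QuantumLattice.szSector (2 * ⌊(1 - δ) * (L : ℝ) ^ 2 / 2⌋₊) 0) → φ ≠ 0 → ∀ lam : ℂ, (Literature.MathematicalPhysics.QuantumLattice.hubbardTorus 2 L 1 U + (Complex.I * (y : ℂ)) • ((((1 : ℝ) / (L : ℝ) ^ 2 : ℝ) : ℂ) • (Matrix.conjTranspose (Literature.MathematicalPhysics.QuantumLattice.pairField Literature.MathematicalPhysics.QuantumLattice.dWaveFormFactor L) * Literature.MathematicalPhysics.QuantumLattice.pairField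 Literature.MathematicalPhysics.QuantumLattice.dWaveFormFactor L))) *ᵥ φ = lam • φ → (Literature.MathematicalPhysics.QuantumLattice.hubbardTorus 2 L 1 U).minEnergyOn (Literature.MathematicalPhysics.QuantumLattice.szSector (2 * ⌊(1 - δ) * (L : ℝ) ^ 2 / 2⌋₊) 0) + ε * (L : ℝ) ^ 2 ≤ lam.re

/-- item stmt-HubbardSuperconductivity-10404 · crux · rank 3 · closed · refuted by Summit.HubbardSuperconductivity.HubbardSuperconductivity.Theorems.KkFloorKkSusceptibilityWindow_refuted @ 6b564c6d0184 (refuter) · by planner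
why it might fail: Curvature of the ground branch = Π-susceptibility χ_L, but the analytic radius in y is ~gap_L/‖Π_L‖ → 0, so no L-uniform window is perturbative; in a Fermi-liquid normal state g=0 is critical for H−gΠ (Cooper log, κ_L ~ log L) and Π_L = O(1) cannot lift extensively: y₁(L) → 0.
sources: doi:10.1016/0003-4916(70)90240-x, doi:10.1103/physrevb.47.7995, Scalapino1995, KomaTasaki1994, Kato1966
[crux] the card's SMALL-y WINDOW (K2 ∧ K3 in output form): ∃ U > 0, δ ∈ (0,1/2), κ > 0, y₁ > 0, L₀
such that for all even L ≥ L₀ and all |y| ≤ y₁, every sector eigenvalue λ of H_L + i y L⁻²Δ_d†Δ_d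
has Re λ ≥ E₀(L) + κ y² L² — the lowest branch lifts at least quadratically with curvature 2κL² (κ =
half the pair-ORDER susceptibility density at g = 0, i.e. g = 0 interior to the ordered phase of the
BCS-deformed family H_L − gΠ_L) and no other branch undercuts it on an L-uniform window. Gives
KkBandLift with band [y₁/2, y₁], ε = κy₁²/4 (KkWindowGivesBand) and floor (2κy₁/π)L⁴ … up to
constants. This is the entry point for the deformation routes: real-g control of E₀(H_L − gΠ_L)
continued to imaginary g. [difficulty: XL] -/
@[route_item "route-HubbardSuperconductivity-KkFloor"]
def KkSusceptibilityWindow : Prop :=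
  ∃ U : ℝ, 0 < U ∧ ∃ δ ∈ Set.Ioo (0:ℝ) (1/2), ∃ κ : ℝ, 0 < κ ∧ ∃ y₁ : ℝ, 0 < y₁ ∧ ∃ L₀ : ℕ, ∀ (L : ℕ) [NeZero L], L₀ ≤ L → Even L → ∀ y : ℝ, |y| ≤ y₁ → ∀ φ : Literature.MathematicalPhysics.QuantumLattice.Fock (Literature.MathematicalPhysics.QuantumLattice.Orb (Literature.MathematicalPhysics.QuantumLattice.FermionTorus 2 L)), φ ∈ (Literature.MathematicalPhysics.QuantumLattice.szSector (2 * ⌊(1 - δ) * (L : ℝ) ^ 2 / 2⌋₊) 0) → φ ≠ 0 → ∀ lam : ℂ, (Literature.MathematicalPhysics.QuantumLattice.hubbardTorus 2 L 1 U + (Complex.I * (y : ℂ)) • ((((1 : ℝ) / (L : ℝ) ^ 2 : ℝ) : ℂ) • (Matrix.conjTranspose (Literature.MathematicalPhysics.QuantumLattice.pairField Literature.MathematicalPhysics.QuantumLattice.dWaveFormFactor L) * Literature.MathematicalPhysics.QuantumLattice.pairField Literature.MathematicalPhysics.QuantumLattice.dWaveFormFactor L))) *ᵥ φ = lam • φ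 → (Literature.MathematicalPhysics.QuantumLattice.hubbardTorus 2 L 1 U).minEnergyOn (Literature.MathematicalPhysics.QuantumLattice.szSector (2 * ⌊(1 - δ) * (L : ℝ) ^ 2 / 2⌋₊) 0) + κ * y ^ 2 * (L : ℝ) ^ 2 ≤ lam.re

/-- item stmt-HubbardSuperconductivity-10405 · crux · rank 4 · closed · moot by None · by planner
why it might fail: Free version FALSE: the minimal-pseudospin projection of the Fermi sea is in ker Δ (uniform weights), sheds only n/(L²−2n+2) ≈ 2 pairs at ρ=0.8, energy E_FS+O(t); d-wave: sl(2)-chain kernel states, shift ratio Σ_FS g²/Σ_out g² < 1. So ε(U) ≲ O(U²), no small-U handle; Nagaoka FM ⊂ ker Δ_d.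
sources: Yang1989, Richardson1963, doi:10.1016/0375-9474(72)90773-7, Nagaoka1966, Tasaki2020, Scalapino1995
[crux] PAIR-VACUUM GAP (card P4(ii); the refuter audit's recommended first target): ∃ U > 0, δ ∈
(0,1/2), ε > 0, L₀ such that for all even L ≥ L₀ every normalised φ in the (N_L, 0) sector with Δ_d
φ = 0 (no d-wave pair can be removed) has ⟨φ, H_L φ⟩ ≥ E₀(L) + εL². It is the y = ∞ end of
KkZenoShelf (a_L(i∞) = min spec of H_L compressed to ker Δ_d ∩ sector), hence NECESSARY for it
(KkShelfNeedsVacuumGap); Hermitian and variational; at small U it reduces to the FREE pair-vacuum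
gap (kernel of the weighted pair-lowering operator Σ_k ĝ_d(k) c_(k↑)c_(−k↓) costs extensive kinetic
energy) plus E₀ ≤ E_FS + UL²ρ²/4. [difficulty: L] -/
@[route_item "route-HubbardSuperconductivity-KkFloor"]
def KkPairVacuumGap : Prop :=
  ∃ U : ℝ, 0 < U ∧ ∃ δ ∈ Set.Ioo (0:ℝ) (1/2), ∃ ε : ℝ, 0 < ε ∧ ∃ L₀ : ℕ, ∀ (L : ℕ) [NeZero L], L₀ ≤ L → Even L → ∀ φ : Literature.MathematicalPhysics.QuantumLattice.Fock (Literature.MathematicalPhysics.QuantumLattice.Orb (Literature.MathematicalPhysics.QuantumLattice.FermionTorus 2 L)), φ ∈ (Literature.MathematicalPhysics.QuantumLattice.szSector (2 * ⌊(1 - δ) * (L : ℝ) ^ 2 / 2⌋₊) 0) → star φ ⬝ᵥ φ = 1 → Literature.MathematicalPhysics.QuantumLattice.pairField Literature.MathematicalPhysics.QuantumLattice.dWaveFormFactor L *ᵥ φ = 0 → (Literature.MathematicalPhysics.QuantumLattice.hubbardTorus 2 L 1 U).minEnergyOn (Literature.MathematicalPhysics.QuantumLattice.szSector (2 * ⌊(1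 - δ) * (L : ℝ) ^ 2 / 2⌋₊) 0) + ε * (L : ℝ) ^ 2 ≤ (Literature.MathematicalPhysics.QuantumLattice.expect (Literature.MathematicalPhysics.QuantumLattice.hubbardTorus 2 L 1 U) φ).re

/-- item stmt-HubbardSuperconductivity-10406 · crux · rank 9 · closed · proved by Summit.HubbardSuperconductivity.HubbardSuperconductivity.Theorems.kkFloorTheorem_proof @ b616d0604289 (prover) · by planner
why it might fail: True on paper (Vesentini + Poisson majorant + Phragmén–Lindelöf) but NOT routine: no subharmonic functions, Vesentini, PL-for-subharmonic or half-plane Poisson kernel in Mathlib (XL build); the 12-binder inlined signature (any S ∋ 0, y<0, any d, ofReal clipping) is arbitrated only by the proof.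
sources: doi:10.1017/cbo9780511623776, doi:10.1016/0362-546x(94)90090-6, doi:10.1016/0003-4916(70)90240-x, Kato1966
[support] the KRAMERS–KRONIG FLOOR (engine; finite-dimensional, classical potential theory, no
physics): for a Hermitian matrix A, a positive semidefinite B (stated as Hermitian with nonnegative
quadratic form), a subspace V invariant under both, a real E below the Rayleigh quotient of A on
unit vectors of V, a unit ψ ∈ V with Aψ = Eψ, a set S ⊆ ℝ and ANY profile d with E + d(y) ≤ Re λ for
every eigenpair (λ, v), v ∈ V ∖ 0, of A + iyB with y ∈ S: ∫_S d(y)⁺ y⁻² dy ≤ π·Re⟨ψ, Bψ⟩ (lower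
Lebesgue integral of ofReal(d(y)/y²)). Proof sketch: a(z) := min Re spec((A + zB)|_V) is continuous
and SUPERharmonic on ℂ (Vesentini: log ρ(exp(−(A+zB)|_V)) = −a(z) is subharmonic; or the
Gelfand-formula sub-mean-value argument); a ≥ E on Re z ≥ 0 by the numerical range (Re λ = ⟨v,Av⟩ +
Re z ⟨v,Bv⟩); w := (E − a) + P[a(i·) − E] is subharmonic on Re z > 0, bounded above, with boundary
values 0, so Phragmén–Lindelöf (auxiliary ε log|z+1|) gives a(x) ≥ E + (1/π)∫ x (a(iy) − E)/(x² +
y²) dy for x > 0; Rayleigh gives a(x) ≤ E + x⟨ψ,Bψ⟩; divide by x and let x → 0⁺ (monotone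
convergence); finally d ≤ a(i·) − E on S and restriction S ⊆ ℝ (lintegral monotonicity, no
measurability needed). Equality iff no under -/
@[route_item "route-HubbardSuperconductivity-KkFloor", crux]
def KkFloorTheorem : Prop :=
  ∀ (n : Type) [Fintype n] [DecidableEq n] (A B : Matrix n n ℂ) (V : Submodule ℂ (n → ℂ)) (E : ℝ) (S : Set ℝ) (d : ℝ → ℝ) (ψ : n → ℂ), A.IsHermitian → B.IsHermitian → (∀ v : n → ℂ, 0 ≤ (star v ⬝ᵥ B *ᵥ v).re) → (∀ v ∈ V, A *ᵥ v ∈ V) → (∀ v ∈ V, B *ᵥ v ∈ V) → (∀ v ∈ V, star v ⬝ᵥ v = 1 → E ≤ (star v ⬝ᵥ A *ᵥ v).re) → ψ ∈ V → star ψ ⬝ᵥ ψ = 1 → A *ᵥ ψ = (E : ℂ) • ψ → (∀ y ∈ S, ∀ v ∈ V, v ≠ 0 → ∀ lam : ℂ, (A + (Complex.I * (y : ℂ)) • B) *ᵥ v = lam • v → E + d y ≤ lam.re) → ∫⁻ y in S, ENNReal.ofReal (d y / y ^ 2) ≤ ENNReal.ofReal (Real.pi * (star ψ ⬝ᵥ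 B *ᵥ ψ).re)

/-- item stmt-HubbardSuperconductivity-10407 · support · rank 9 · closed · proved by Summit.HubbardSuperconductivity.HubbardSuperconductivity.Theorems.kkShelfGivesBand_proof (prover) · by planner
sources: doi:10.1017/cbo9780511623776
[support] KkZenoShelf → KkBandLift with the same (U, δ, ε, L₀) and the band [Y, Y+1]; pure logic
(proved as an example in the planner's Sketch.lean). [difficulty: provable-now] -/
@[route_item "route-HubbardSuperconductivity-KkFloor"]
def KkShelfGivesBand : Prop :=
  KkZenoShelf → KkBandLift

/-- item stmt-HubbardSuperconductivity-10408 · support · rank 9 · closed · proved by Summit.HubbardSuperconductivity.HubbardSuperconductivity.Theorems.kkWindowGivesBand_proof (prover) · by planner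
sources: doi:10.1017/cbo9780511623776
[support] KkSusceptibilityWindow → KkBandLift with the band [y₁/2, y₁] and ε := κ(y₁/2)² (κy²L² ≥
κ(y₁/2)²L² on the band); two lines of arithmetic (proved as an example in the planner's
Sketch.lean). [difficulty: provable-now] -/
@[route_item "route-HubbardSuperconductivity-KkFloor"]
def KkWindowGivesBand : Prop :=
  KkSusceptibilityWindow → KkBandLift

/-- item stmt-HubbardSuperconductivity-10409 · support · rank 9 · closed · proved by Summit.HubbardSuperconductivity.HubbardSuperconductivity.Theorems.kkShelfNeedsVacuumGap_proof @ ce935225d5c3 (prover) · by planner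
sources: Kato1966, doi:10.1103/physreva.107.033332
[support] pointwise Zeno limit: for fixed (U, δ, ε, Y, L), if every sector eigenvalue of H_L + i y
L⁻²Δ_d†Δ_d has real part ≥ E₀(L) + εL² for all y ≥ Y, then every normalised sector vector φ with Δ_d
φ = 0 has ⟨φ,H_Lφ⟩ ≥ E₀(L) + εL². Proof: K := ker Δ_d ∩ sector = ker Π_L ∩ sector; as y → ∞ exactly
dim K eigenvalues of (H_L + iyΠ_L)|_sector converge to spec(P_K H_L P_K |_K) (first-order reduction
of the analytic family Π_L + εH_L, ε = 1/(iy), at the semisimple eigenvalue 0 of the Hermitian Π_L),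
the others have |Im| → ∞; pass to the limit in the shelf inequality and use min spec(P_K H_L P_K|_K)
≤ ⟨φ,H_Lφ⟩. Makes KkPairVacuumGap a genuine kill test for KkZenoShelf. [difficulty: M] -/
@[route_item "route-HubbardSuperconductivity-KkFloor"]
def KkShelfNeedsVacuumGap : Prop :=
  ∀ (U δ ε Y : ℝ) (L : ℕ) [NeZero L], (∀ y : ℝ, Y ≤ y → ∀ φ : Literature.MathematicalPhysics.QuantumLattice.Fock (Literature.MathematicalPhysics.QuantumLattice.Orb (Literature.MathematicalPhysics.QuantumLattice.FermionTorus 2 L)), φ ∈ (Literature.MathematicalPhysics.QuantumLattice.szSector (2 * ⌊(1 - δ) * (L : ℝ) ^ 2 / 2⌋₊) 0) → φ ≠ 0 → ∀ lam : ℂ, (Literature.MathematicalPhysics.QuantumLattice.hubbardTorus 2 L 1 U + (Complex.I * (y : ℂ)) • ((((1 : ℝ) / (L : ℝ) ^ 2 : ℝ) : ℂ) • (Matrix.conjTranspose (Literature.MathematicalPhysics.QuantumLattice.pairField Literature.MathematicalPhysics.QuantumLattice.dWaveFormFactor L) * Literature.MathematicalPhysics.QuantumLattice.pairField Literature.MathematicalPhysics.QuantumLattice.dWaveFormFactor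 L))) *ᵥ φ = lam • φ → (Literature.MathematicalPhysics.QuantumLattice.hubbardTorus 2 L 1 U).minEnergyOn (Literature.MathematicalPhysics.QuantumLattice.szSector (2 * ⌊(1 - δ) * (L : ℝ) ^ 2 / 2⌋₊) 0) + ε * (L : ℝ) ^ 2 ≤ lam.re) → ∀ φ : Literature.MathematicalPhysics.QuantumLattice.Fock (Literature.MathematicalPhysics.QuantumLattice.Orb (Literature.MathematicalPhysics.QuantumLattice.FermionTorus 2 L)), φ ∈ (Literature.MathematicalPhysics.QuantumLattice.szSector (2 * ⌊(1 - δ) * (L : ℝ) ^ 2 / 2⌋₊) 0) → star φ ⬝ᵥ φ = 1 → Literature.MathematicalPhysics.QuantumLattice.pairField Literature.MathematicalPhysics.QuantumLattice.dWaveFormFactor L *ᵥ φ = 0 → (Literature.MathematicalPhysics.QuantumLattice.hubbardTorus 2 L 1 U).minEnergyOn (Literature.MathematicalPhysics.QuantumLattice.szSector (2 * ⌊(1 - δ) * (L : ℝ) ^ 2 / 2⌋₊) 0) + ε * (L : ℝ) ^ 2 ≤ (Literature.MathematicalPhysics.QuantumLattice.expect (Literature.MathematicalPhysics.QuantumLattice.hubbardTorus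 2 L 1 U) φ).re

/-- item stmt-HubbardSuperconductivity-10410 · support · rank 9 · closed · proved by Summit.HubbardSuperconductivity.HubbardSuperconductivity.Theorems.kkLiftToSummit_proof @ f9809bff46a0 (prover) · by planner
sources: Scalapino1995, ArovasBergKivelsonRaghu2022, Lieb1989
[support] bookkeeping glue KkFloorTheorem → KkBandLift → HubbardSuperconductivity: at the witness
(U,δ) of KkBandLift and even L ≥ max(L₀,2), instantiate KkFloorTheorem with n = the Fock basis, A =
H_L, B = Π_L = ((1/L²:ℝ):ℂ)•(Δ_dᴴΔ_d) (Hermitian, nonnegative form: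
pairField_conjTranspose_mul_self_posSemidef), V = szSector N_L 0 (invariant under H_L and Δ_dᴴΔ_d:
both conserve N and S^z), E = E₀(L) (≤ every unit Rayleigh quotient on the sector: csInf_le with
BddBelow; a normalised sector ground state ψ is an eigenvector with eigenvalue E₀ by
IsGroundStateInSector), S = [Y₁,Y₂], d ≡ εL²: the floor gives π L⁻² Re⟨ψ,Δ_dᴴΔ_dψ⟩ ≥ ∫_[Y₁,Y₂] εL²
y⁻² dy ≥ εL²(Y₂−Y₁)/Y₂², i.e. Re⟨ψ,Δ_dᴴΔ_dψ⟩ ≥ cL⁴ with c = ε(Y₂−Y₁)/(πY₂²) for EVERY normalised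
sector ground state; then the summit (= ∃ U>0, δ ∈ Ioo 0 (1/2), HasDWavePairFieldLROAt U δ by
Iff.rfl) follows by the even-side liminf bookkeeping already proved in
Theorems/WeakCouplingBCSWcbcsThesis.lean (hasTorusLRO_of_eventually_le, sum_pairFieldCorr_succ,
pairFieldCorr_succ_le keep the real liminf honest; restrict to even L = 2k as in
hasDWavePairFieldLROAt_of_forall_hasPairFieldLRO). Same task as TwistGap's TgThesisToSummit modulo
the floor. [diff -/
@[route_item "route-HubbardSuperconductivity-KkFloor", crux]
def KkLiftToSummit : Prop :=
  KkFloorTheorem → KkBandLift → HubbardSuperconductivity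

-- earlier Assembly (stmt-HubbardSuperconductivity-10411, replaced 2026-08-16T10:08:20Z -> stmt-HubbardSuperconductivity-15170): proved by Summit.HubbardSuperconductivity.HubbardSuperconductivity.Theorems.kkFloor_assembly_proof — KkFloorTheorem → KkBandLift → KkLiftToSummit → HubbardSuperconductivity
/-- item stmt-HubbardSuperconductivity-15170 · assembly · rank 1 · closed · proved by Summit.HubbardSuperconductivity.HubbardSuperconductivity.Theorems.kkFloorAssembly_proof @ 9e34b36cda67 (prover) · by planner
sources: Scalapino1995, doi:10.1017/cbo9780511623776
[assembly] frame statement X → Statement with X = KkBandLift (cruxes only): the Kramers–Kronig floor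
(support KkFloorTheorem) instantiated at the witness (U, δ) of KkBandLift with A = H_L, B = Π_L =
L⁻²Δ_dᴴΔ_d, V = the (N_L, 0) sector, E = E₀(L), S = [Y₁,Y₂], d ≡ εL² gives Re⟨ψ, Δ_dᴴΔ_d ψ⟩ ≥
ε(Y₂−Y₁)/(πY₂²)·L⁴ for every normalised sector ground state, hence the summit (support
KkLiftToSummit, proved). Either ranked crux reaches X by the proved band glue (KkShelfGivesBand /
KkWindowGivesBand). Proof once KkFloorTheorem lands: `fun b => kkLiftToSummit_proof
kkFloorTheorem_proof b` (planner Sketch.lean rc 0: `example (hF : KkFloorTheorem) (hL :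
KkLiftToSummit) : KkBandLift → HubbardSuperconductivity := fun b => hL hF b`). Restated
(route-repair, ground-failed) from the rev-1 form `KkFloorTheorem → KkBandLift → KkLiftToSummit →
HubbardSuperconductivity`, which is the type of `closes` and was flagged ground.trivial (tauto:
KkLiftToSummit unfolds to the remaining implication); the supports are now used inside the proof,
not assumed. Deps: KkFloorTheorem (open support), KkLiftToSummit (proved). [difficulty: provable-now
modulo KkFloorTheorem] -/
@[route_item "route-HubbardSuperconductivity-KkFloor"]
def Assembly : Prop :=
  KkBandLift → _root_.HubbardSuperconductivity

/-! D-0027 §2.1 — DECIDING THEOREM (planner-authored via `route open/edit --closes-file`; by planner-rbadge-HubbardSuperconductivity-KkFloo-88b68784-0 2026-08-16T10:24:35Z) — ARCHIVED: route closed (refuted) 2026-08-19T01:44:35Z; kept so importers keep building: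
its hypotheses are this route's items and its conclusion the sub-problem Statement (glue_lint), and it elaborates with this file. -/

@[closes "route-HubbardSuperconductivity-KkFloor"] theorem closes (h₁ : KkFloorTheorem) (h₂ : KkBandLift) (h₃ : KkLiftToSummit) : HubbardSuperconductivity :=
  h₃ h₁ h₂

end Summit.HubbardSuperconductivity.HubbardSuperconductivity.Theses.KkFloor
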